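import Summits.BirchSwinnertonDyer.BirchSwinnertonDyer.Theorems.PrintCFramBottomClassIndexLawFiveLeKrizLiBindersTwist
import Summits.BirchSwinnertonDyer.BirchSwinnertonDyer.Theorems.PrintCFramBottomClassIndexLawFiveLeKrizLiBindersKroneckerField
import Summits.BirchSwinnertonDyer.BirchSwinnertonDyer.Theorems.PrintCFramBottomClassIndexLawFiveLeAnchorBernoulli163Twin
import Summits.BirchSwinnertonDyer.BirchSwinnertonDyer.Theorems.PrintCFramBottomClassIndexLawFiveLeRegularLocusBernoulliPairOdd
import Mathlib.Tactic.NormNum.LegendreSymbol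
import HarnessLib

/-!
# Crux `PrintCFram.BottomClassIndexLawFiveLe` (stmt-BirchSwinnertonDyer-20372), line `eisenstein-resource-bdp-line`:
# THE ANCHOR INSTANCE — at `(A(163), p = 163, K'' = ℚ(√−7))` the CHARACTER ∧ `ε_K` ∧ BERNOULLI-(4) block of the Kriz–Li datum
# is a THEOREM: `ψ = ω^{41}` (odd, primitive, `hss`, (1), (3)), `ε_K = (·/7)`, and `163 ∤ B_{1,ω^{121}} · B_{1,χ_{−7}ω^{40}}`
# (cell `bsd-print-cfram`, width seat `bsd-line-cfram-p1-w3` g2; THEOREMS ONLY, `--supports` 20372; BSD is not proved by any of this)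

HONEST FRAMING. Nothing here is a statement about BSD; no stub is closed; Kriz–Li Thm. 1.20 itself stays the PRINT stub `stub_krizLi`.
LEAD g5's report (§3) named the triple `(A(163), 163, ℚ(√−7))` «inhabited» for the Kriz–Li datum: hypothesis (4) is w2's two kernel
certificates `‖B_{1,ω^{121}}‖_{163} = 1` (p609511) and `‖B_{1,χ_{−7}ω^{40}}‖_{163} = 1` (p611027), the trace form
`a_ℓ(A(163)) ≡ ℓ^{41} + ℓ^{122}` (p611699) is `hss` — «price list: the KL binder packaging (ψ = ω^{41} as a primitive
`DirichletCharacter ℚ_[163] 163`, (1), (3)), `ε_{ℚ(√−7)}` as `IsKroneckerCharacterOf`». THIS FILE PAYS THAT PRICE in the kernel: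

* `krizLi_characterBernoulliBlock_A163` — for every `W ∼ A(163)` (`IsIsogenous W cm163`), every Teichmüller `ω` mod `163` and
  every `ℚ_163`-valued `εK` of level `7` with values `J(· | 7)`: the character `ψ := 1↑·(ω^{41})↑` (level `163·1`) is PRIMITIVE and
  ODD, satisfies `hss`, (1), (3) for `W` (part T's engine with `m = 1`, `χ = 1`, `k = 41`), AND hypothesis (4)
  `¬ ‖bernoulliOnePrim (bernoulliCharOne ψ εK) · bernoulliOnePrim (bernoulliCharTwo ψ εK ω)‖ ≤ 163⁻¹` — via w2 g4's odd-pair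
  reduction (`ψ₀⁻¹ε_K = ψ⁻¹ = ω^{121}`, `ψ₀ω⁻¹ = ψε_Kω⁻¹ = χ_{−7}ω^{40}`), the two certificates and Route U's `bernoulli_hypothesis_of_certs`.
* `exists_krizLiCharacterBlock_A163` — for every quadratic field `K''` with `d_{K''} = −7`: the binders
  `(f, ψ, ω, εK)` with `ψ.IsPrimitive ∧ IsTeichmullerCharacter ω ∧ hss ∧ (1) ∧ (3) ∧ IsKroneckerCharacterOf K'' εK ∧ (4)` —
  i.e. the hypotheses `f ψ ω hψ hω hss h1 h1' h3 εK hεK h4` of LEAD g5's `RegularLocus.ramifiedCMBottomClassIndexLawAtZp_of_regularKrizLiDatum`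
  and of LEAD g6's `…KrizLiLocusKolyvagin` theorems, AT THIS TRIPLE. What such a theorem still asks there: the Heegner data
  (`Dt`, `H`, `P`; `163` splits in `ℚ(√−7)`), `L(A(163)^{(−7)}, 1) ≠ 0`, and regularity / the Kolyvagin UPPER half.

beyond-print theorem: NO. References: [KrizLi2019] Thm. 1.20 (pp. 7–8), Rem. 1.21, §1.5, §2; [Rubin1983] Thm. C ((p−3)/4 = 40);
[BuhlerGross1985] Ch. II (8.3); [Washington1997] §5.1, Thm. 4.2; [Cox2013] §1.C Lemma 1.14.
-/

noncomputable section

-- summit-side namespace `Summit.BirchSwinnertonDyer.BirchSwinnertonDyer.…` (single-conjunct summit, D-0017 layout)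
set_option linter.dupNamespace false

open scoped Classical NumberTheorySymbols
open NumberField WeierstrassCurve DirichletCharacter
open Literature.NumberTheory.EllipticCurves Literature.NumberTheory.EllipticCurves.KrizLi2019
open Literature.NumberTheory.EllipticCurves.Rank1Residual Literature.NumberTheory.LFunctions
open Summit.BirchSwinnertonDyer.Rank1Residual Summit.BirchSwinnertonDyer.Rank1Residual.X12.O11

namespace Summit.BirchSwinnertonDyer.BirchSwinnertonDyer.Theorems.PrintCFram.KrizLiBinders

/-! ## §1 Small character identities at `p = 163` -/

section P163

variable [hp : Fact (Nat.Prime 163)] (ω : DirichletCharacter ℚ_[163] 163)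

/-- `ω^{162} = 1` for a character mod `163` (values at units are `162`-nd roots of unity). [cite: Washington1997, §5.1] -/
theorem teichmuller163_pow_162 : ω ^ 162 = 1 := by
  refine MulChar.ext fun u => ?_
  rw [MulChar.pow_apply_coe, MulChar.one_apply_coe]
  have hu : ¬ ((163 : ℤ) ∣ (((u : ZMod 163).val : ℕ) : ℤ)) := by
    intro h
    have h' : 163 ∣ (u : ZMod 163).val := by exact_mod_cast h
    have := ZMod.val_coe_unit_coprime u
    exact absurd (Nat.Coprime.eq_one_of_dvd this.symm h') (by norm_num)
  have := apply_pow_sub_one_eq_one ω _ hu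
  simpa [ZMod.natCast_zmod_val] using this

/-- `(ω^{41})⁻¹ = ω^{121}`. [cite: Washington1997, §5.1] -/
theorem teichmuller163_pow_41_inv : (ω ^ 41)⁻¹ = ω ^ 121 :=
  inv_eq_of_mul_eq_one_right (by rw [← pow_add]; exact teichmuller163_pow_162 ω)

/-- `ω^{41}·ω⁻¹ = ω^{40}`. [folklore] -/
theorem teichmuller163_pow_41_mul_inv : ω ^ 41 * ω⁻¹ = ω ^ 40 := by
  rw [show (41 : ℕ) = 40 + 1 from rfl, pow_succ, mul_inv_cancel_right]

/-- The values of `θ₂ := εK↑·(ω^{40})↑` at level `163·7`, in the shape consumed by w2's certificate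
`AnchorReduction.norm_generalizedBernoulli_theta2_A163`: `θ₂(j) = (j/7)·ω(j)^{40}` at EVERY residue `j`.
[cite: KrizLi2019, §2 (p. 11, conventions on characters)] -/
theorem thetaTwo163_apply (εK : DirichletCharacter ℚ_[163] 7) (hεK : ∀ a : ℕ, εK (a : ZMod 7) = (J((a : ℤ) | 7) : ℚ_[163]))
    (j : ZMod (163 * 7)) :
    (changeLevel (dvd_mul_left 7 163) εK * changeLevel (dvd_mul_right 163 7) (ω ^ 40) :
      DirichletCharacter ℚ_[163] (163 * 7)) j =
      (legendreSym 7 (j.val : ℤ) : ℚ_[163]) * ω (j.val : ZMod 163) ^ 40 := by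
  haveI : Fact (Nat.Prime 7) := ⟨by norm_num⟩
  have hj : ((j.val : ℤ) : ZMod (163 * 7)) = j := by rw [Int.cast_natCast, ZMod.natCast_zmod_val]
  rw [jacobiSym.legendreSym.to_jacobiSym]
  by_cases hu : IsCoprime (j.val : ℤ) ((163 * 7 : ℕ) : ℤ)
  · conv_lhs => rw [← hj]
    rw [MulChar.mul_apply, changeLevel_eq_cast_of_dvd' _ _ hu, changeLevel_eq_cast_of_dvd' _ _ hu,
      MulChar.pow_apply' _ (by norm_num), Int.cast_natCast, Int.cast_natCast, hεK]
  · have hnu : ¬ IsUnit j := by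
      rw [← hj, ZMod.coe_int_isUnit_iff_isCoprime]; exact fun h => hu (by simpa [isCoprime_comm] using h)
    rw [MulChar.map_nonunit _ hnu]
    have h77 : ¬ (j.val).Coprime (163 * 7) := fun h => hu (Nat.isCoprime_iff_coprime.mpr h)
    rw [Nat.coprime_mul_iff_right, not_and_or] at h77
    rcases h77 with h7 | hmm
    · have hd : 163 ∣ j.val := by
        rwa [Nat.coprime_comm, Nat.Prime.coprime_iff_not_dvd hp.out, not_not] at h7
      have h0 : (j.val : ZMod 163) = 0 := (ZMod.natCast_eq_zero_iff _ _).mpr hd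
      rw [h0, MulChar.map_zero, zero_pow (by norm_num), mul_zero]
    · have hd : 7 ∣ j.val := by
        rwa [Nat.coprime_comm, Nat.Prime.coprime_iff_not_dvd (by norm_num), not_not] at hmm
      rw [jacobiSym.eq_zero_iff_not_coprime.mpr (by
        rw [Int.gcd_natCast_natCast]; exact fun h => by
          have := Nat.Coprime.eq_one_of_dvd (Nat.Coprime.symm h) hd; norm_num at this), Int.cast_zero, zero_mul]

end P163

/-! ## §2 The anchor instance `(A(163), 163, ℚ(√−7))` -/

set_option maxRecDepth 20000 in
/-- **THE CHARACTER ∧ BERNOULLI BLOCK AT `(A(163), 163, ℚ(√−7))`.** For every `W ∼ A(163)` over `ℚ`, every Teichmüller `ω`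
mod `163` and every `ℚ_163`-valued `εK` of level `d = 7` with values `J(· | 7)` (the Kronecker character of `ℚ(√−7)`): the
character `ψ := 1↑·(ω^{41})↑` of level `163·1` is PRIMITIVE and ODD, satisfies the Kriz–Li binders `hss` (`∀ ℓ ∤ 163·N_W`),
(1), (3) for `W` verbatim, AND the Bernoulli hypothesis (4) `¬ ‖B_{1,ψ₀⁻¹ε_K}·B_{1,ψ₀ω⁻¹}‖ ≤ 163⁻¹` in the fact's idiom.
[cite: KrizLi2019, Thm. 1.20 (pp. 7–8), Rem. 1.21, §2] [cite: BuhlerGross1985, Ch. II (8.3)(1) (p. 18)] [cite: Rubin1983, §0 Thm. C (p. 341)] -/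
theorem krizLi_characterBernoulliBlock_A163 [hp : Fact (Nat.Prime 163)] (W : WeierstrassCurve ℚ) [W.IsElliptic]
    (hiso : IsIsogenous W cm163) (ω : DirichletCharacter ℚ_[163] 163) (hω : IsTeichmullerCharacter ω)
    {d : ℕ} (hd : d = 7) [NeZero d] (εK : DirichletCharacter ℚ_[163] d)
    (hεK : ∀ a : ℕ, εK (a : ZMod d) = (J((a : ℤ) | 7) : ℚ_[163])) :
    ∃ (f : ℕ) (_ : NeZero f) (ψ : DirichletCharacter ℚ_[163] f),
      ψ.IsPrimitive ∧ ψ.Odd ∧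
      (∀ ℓ : ℕ, ℓ.Prime → ¬ (ℓ ∣ 163 * W.conductorNorm ℤ) →
        ‖((W.LFunction ℓ : ℤ) : ℚ_[163]) - (ψ (ℓ : ZMod f) + ψ⁻¹ (ℓ : ZMod f) * ω (ℓ : ZMod 163))‖ < 1) ∧
      (ψ ((163 : ℕ) : ZMod f) ≠ 1 ∧ primVal (invMulOmega ψ ω) 163 ≠ 1) ∧
      (∀ ℓ : ℕ, (hℓ : ℓ.Prime) → ℓ ≠ 163 →
        (haveI := Fact.mk hℓ; ¬ W.HasGoodReductionAtPrime ℓ ∧ ¬ W.HasMultiplicativeReductionAtPrime ℓ) →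
        ψ (ℓ : ZMod f) ≠ 1 ∧ primVal (invMulOmega ψ ω) ℓ ≠ 1) ∧
      ¬ (‖bernoulliOnePrim (bernoulliCharOne ψ εK) * bernoulliOnePrim (bernoulliCharTwo ψ εK ω)‖ ≤ ((163 : ℕ) : ℝ)⁻¹) ∧
      (∀ a : ℕ, a.Coprime 163 → ψ (a : ZMod f) = ω (a : ZMod 163) ^ 41) := by
  subst hd
  haveI : Fact (Nat.Prime 7) := ⟨by norm_num⟩
  -- the engine with `m = 1`, `χ = 1`, `k = 41`
  have h1prim : (1 : DirichletCharacter ℚ_[163] 1).IsPrimitive := by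
    rw [isPrimitive_def, conductor_one]
  have h1quad : (1 : DirichletCharacter ℚ_[163] 1).IsQuadratic := fun a =>
    Or.inr (Or.inl (MulChar.one_apply (isUnit_of_subsingleton a)))
  have hval1 : ∀ a : ℕ, (1 : DirichletCharacter ℚ_[163] 1) (a : ZMod 1) = ((1 : ℤ) : ℚ_[163]) := fun a => by
    rw [MulChar.one_apply (isUnit_of_subsingleton _), Int.cast_one]
  have hLW : W.LFunction = cm163.LFunction := hiso.LFunction_eq
  have htr : ∀ ℓ : ℕ, ℓ.Prime → ℓ ≠ 163 →
      ((W.LFunction ℓ : ℤ) : ZMod 163) = ((1 : ℤ) : ZMod 163) * ((ℓ : ZMod 163) ^ 41 + (ℓ : ZMod 163) ^ (163 - 41)) := by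
    intro ℓ hℓ hne
    haveI := Fact.mk hℓ
    rw [hLW, Int.cast_one, one_mul]
    exact AnchorReduction.lFunction_cm163_mod ℓ hne
  have hgoodW : ∀ ℓ : ℕ, (hℓ : ℓ.Prime) → ℓ ≠ 163 → ¬ ℓ ∣ 1 → (haveI := Fact.mk hℓ; W.HasGoodReductionAtPrime ℓ) := by
    intro ℓ hℓ hne _
    haveI := Fact.mk hℓ
    exact (hiso.hasGoodReductionAtPrime_iff ℓ).mpr (AnchorReduction.hasGoodReductionAtPrime_cm163 ℓ hne)
  obtain ⟨hprim, hss, h1, h3⟩ := krizLiBinders_of_data (p := 163) (by norm_num) W (1 : DirichletCharacter ℚ_[163] 1)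
    h1prim h1quad (Nat.coprime_one_left 163) (fun _ => 1) (fun a _ _ => hval1 a) (k := 41) (by norm_num) (by norm_num)
    htr hgoodW ω hω
  set ψ : DirichletCharacter ℚ_[163] (163 * 1) :=
    changeLevel (dvd_mul_left 1 163) (1 : DirichletCharacter ℚ_[163] 1) * changeLevel (dvd_mul_right 163 1) (ω ^ 41)
    with hψdef
  -- parity
  have hodd : ψ.Odd := by
    rw [hψdef]
    refine psi_odd_of ω (1 : DirichletCharacter ℚ_[163] 1) 41 (by norm_num) hω (by norm_num) ?_
    rw [MulChar.one_apply (isUnit_of_subsingleton _)]; norm_num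
  have hnev : ¬ ψ.Even := hodd.not_even
  -- the values `ψ(a) = ω(a)^41` at `a` coprime to `163`
  have hval : ∀ a : ℕ, a.Coprime 163 → ψ (a : ZMod (163 * 1)) = ω (a : ZMod 163) ^ 41 := by
    intro a ha
    rw [hψdef, psi_apply_natCast_of_coprime ω (1 : DirichletCharacter ℚ_[163] 1) 41 (by norm_num) (by simpa using ha),
      MulChar.one_apply (isUnit_of_subsingleton _), one_mul]
  haveI : NeZero (163 * 1) := ⟨by norm_num⟩
  refine ⟨163 * 1, inferInstance, ψ, hprim, hodd, hss, h1, h3, ?_, hval⟩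
  -- (4): the two Bernoulli characters are lifts of `θ₁ = ω^121` and `θ₂ = εK↑·(ω^40)↑`
  have hψinv : ψ⁻¹ = changeLevel (dvd_mul_right 163 1) (ω ^ 121) := by
    rw [hψdef, changeLevel_one, one_mul, ← map_inv, teichmuller163_pow_41_inv]
  -- θ₁
  have hθ₁ne : ω ^ 121 ≠ 1 := teichmuller_pow_ne_one hω (by norm_num) (by norm_num)
  have hθ₁ : (ω ^ 121).IsPrimitive := by
    rw [isPrimitive_def]; exact RouteU.conductor_eq_of_prime_of_ne_one (ω ^ 121) hθ₁ne
  have hu₁ : ‖generalizedBernoulli 1 (ω ^ 121)‖ = 1 := by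
    rw [← RouteU.bernoulliOnePrim_eq_of_isPrimitive (ω ^ 121) hθ₁]
    exact AnchorReduction.norm_bernoulliOnePrim_teichmuller_pow_121_p163 ω hω
  have hχ₁ : bernoulliCharOne ψ εK =
      changeLevel ((dvd_mul_right 163 1).trans (dvd_mul_right (163 * 1) 7)) (ω ^ 121) := by
    rw [RegularLocusBernoulliPair.bernoulliCharOne_of_not_even ψ εK hnev, hψinv, ← changeLevel_trans]
  -- θ₂
  set θ₂ : DirichletCharacter ℚ_[163] (163 * 7) :=
    changeLevel (dvd_mul_left 7 163) εK * changeLevel (dvd_mul_right 163 7) (ω ^ 40) with hθ₂def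
  have hεK1 : εK ≠ 1 := by
    intro h
    have h3 := hεK 3
    rw [h, MulChar.one_apply ((ZMod.isUnit_iff_coprime 3 7).mpr (by norm_num))] at h3
    have hJ : J(((3 : ℕ) : ℤ) | 7) = -1 := by norm_num
    rw [hJ] at h3; norm_num at h3
  have hω40 : ω ^ 40 ≠ 1 := teichmuller_pow_ne_one hω (by norm_num) (by norm_num)
  have hθ₂ : θ₂.IsPrimitive := by
    have hc7 : εK.conductor = 7 := RouteU.conductor_eq_of_prime_of_ne_one εK hεK1
    have hc163 : (ω ^ 40).conductor = 163 := RouteU.conductor_eq_of_prime_of_ne_one (ω ^ 40) hω40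
    rw [isPrimitive_def, hθ₂def, RouteU.conductor_changeLevel_mul_changeLevel _ _ εK (ω ^ 40)
      (by rw [hc7, hc163]; norm_num), hc7, hc163]
  have hu₂ : ‖generalizedBernoulli 1 θ₂‖ = 1 :=
    AnchorReduction.norm_generalizedBernoulli_theta2_A163 ω hω θ₂ (thetaTwo163_apply ω εK hεK)
  have h₂ : 163 * 7 ∣ 163 * 1 * 7 * 163 := ⟨163, by norm_num⟩
  have hχ₂ : bernoulliCharTwo ψ εK ω = changeLevel h₂ θ₂ := by
    rw [RegularLocusBernoulliPair.bernoulliCharTwo_of_not_even ψ εK ω hnev, hθ₂def, hψdef]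
    simp only [map_mul, changeLevel_one, one_mul, ← changeLevel_trans]
    rw [← teichmuller163_pow_41_mul_inv ω, map_mul, mul_comm (changeLevel _ (ω ^ 41)) (changeLevel _ εK)]
    exact mul_assoc _ _ _
  exact RouteU.bernoulli_hypothesis_of_certs (ω ^ 121) hθ₁ _ θ₂ hθ₂ h₂ _ hχ₁ _ hχ₂ hu₁ hu₂

/-- **THE KRIZ–LI CHARACTER BLOCK AT `(A(163), 163, K'')` FOR EVERY QUADRATIC FIELD `K''` OF DISCRIMINANT `−7`.** For every
`W ∼ A(163)` over `ℚ` and every quadratic field `K''` with `d_{K''} = −7`: there are `f`, `ψ`, `ω`, `εK` with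
`ψ.IsPrimitive ∧ IsTeichmullerCharacter ω ∧ hss ∧ (1) ∧ (3) ∧ IsKroneckerCharacterOf K'' εK ∧ (4)` (and `ψ` odd) — the hypotheses
`f ψ ω hψ hω hss h1 h1' h3 εK hεK h4` of LEAD g5's `RegularLocus.ramifiedCMBottomClassIndexLawAtZp_of_regularKrizLiDatum` and of the
line's v6 «Kriz–Li datum», AT THIS TRIPLE, discharged in the kernel (`ω` by Hensel, `εK = (·/7)` by part E, the rest by
`krizLi_characterBernoulliBlock_A163`). What remains there for a Kriz–Li datum at `A(163)`: the Heegner data over `K''`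
(`Dt`, `H`, `P`), `L(A(163)^{(−7)}, 1) ≠ 0`, and the frame's regularity (regular locus) or the Kolyvagin UPPER half (LEAD g6).
[cite: KrizLi2019, Thm. 1.20 (pp. 7–8), Rem. 1.21, §2 (p. 12)] [cite: Cox2013, §1.C Lemma 1.14] [cite: Washington1997, §5.1] -/
theorem exists_krizLiCharacterBlock_A163 [Fact (Nat.Prime 163)] (W : WeierstrassCurve ℚ) [W.IsElliptic]
    (hiso : IsIsogenous W cm163) (K : Type) [Field K] [NumberField K] (hK2 : Module.finrank ℚ K = 2)
    (hdK : NumberField.discr K = -7) [NeZero (NumberField.discr K).natAbs] :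
    ∃ (f : ℕ) (_ : NeZero f) (ψ : DirichletCharacter ℚ_[163] f) (ω : DirichletCharacter ℚ_[163] 163)
      (εK : DirichletCharacter ℚ_[163] (NumberField.discr K).natAbs),
      ψ.IsPrimitive ∧ IsTeichmullerCharacter ω ∧
      (∀ ℓ : ℕ, ℓ.Prime → ¬ (ℓ ∣ 163 * W.conductorNorm ℤ) →
        ‖((W.LFunction ℓ : ℤ) : ℚ_[163]) - (ψ (ℓ : ZMod f) + ψ⁻¹ (ℓ : ZMod f) * ω (ℓ : ZMod 163))‖ < 1) ∧
      (ψ ((163 : ℕ) : ZMod f) ≠ 1 ∧ primVal (invMulOmega ψ ω) 163 ≠ 1) ∧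
      (∀ ℓ : ℕ, (hℓ : ℓ.Prime) → ℓ ≠ 163 →
        (haveI := Fact.mk hℓ; ¬ W.HasGoodReductionAtPrime ℓ ∧ ¬ W.HasMultiplicativeReductionAtPrime ℓ) →
        ψ (ℓ : ZMod f) ≠ 1 ∧ primVal (invMulOmega ψ ω) ℓ ≠ 1) ∧
      IsKroneckerCharacterOf K εK ∧
      ¬ (‖bernoulliOnePrim (bernoulliCharOne ψ εK) * bernoulliOnePrim (bernoulliCharTwo ψ εK ω)‖ ≤ ((163 : ℕ) : ℝ)⁻¹) ∧
      ψ.Odd := by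
  obtain ⟨ω, hω⟩ := exists_isTeichmullerCharacter (p := 163)
  have h7 : Squarefree (7 : ℕ) := (Nat.prime_iff.mp (by norm_num : Nat.Prime 7)).squarefree
  obtain ⟨εK, hεK, hεKval⟩ := exists_isKroneckerCharacterOf_of_discr (p := 163) hK2 h7
    (Or.inr ⟨by rw [hdK]; norm_num, by norm_num⟩)
  have hd : (NumberField.discr K).natAbs = 7 := by rw [hdK]; rfl
  obtain ⟨f, hf, ψ, hprim, hodd, hss, h1, h3, h4, -⟩ :=
    krizLi_characterBernoulliBlock_A163 W hiso ω hω hd εK hεKval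
  exact ⟨f, hf, ψ, ω, εK, hprim, hω, hss, h1, h3, hεK, h4, hodd⟩

end Summit.BirchSwinnertonDyer.BirchSwinnertonDyer.Theorems.PrintCFram.KrizLiBinders

end
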